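import Summits.SmoothPoincare4.SmoothPoincare4.Theses.InformationMetricHadamard
import Literature.Geometry.Manifold.InverseFunctionTheorem
import Literature.Geometry.Lorentzian.Isometry

/-!
# Stub `stub_farCollarIsFar` of line `Sketch` (crux `InformationMetricHadamard.C0AhRecognition`)

Deep points of a `C⁰`-cone collar `Ψ : N × (0,1) → W⁵` (smooth, injective, immersive and
`G ∘ dΨ = (1 ± 1/2) c (dl² + gN)/l²` below a depth `T`) are metrically far from any base point:
`d_G(x₀, Ψ(y,l)) → ∞` as `l → 0`, uniformly in `y` (`N` compact).

* `collar_localInverse` — near `Ψ p`, `p ∈ N × (0,T)`, every point lies in `Ψ(N × (0,T))` and the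
  global inverse `Ψ⁻¹ = invFunOn Ψ (N × (0,1))` is smooth (inverse function theorem, `4 + 1 = 5`);
* `contMDiffAt_logDepth`, `mfderiv_logDepth_mfderiv` — the logarithmic depth `log λ`,
  `λ = pr₂ ∘ Ψ⁻¹`, is smooth on the far part and `d(log λ)(dΨ(v, s)) = s / l`;
* `sqrt_mul_abs_le_norm` — the cone asymptotics give `√(c/2) |d(log λ)(w)| ≤ |w|_G`;
* `ofReal_logDepth_le_pathELength` — hence `L(γ|[0,s]) ≥ √(c/2) |log λ(γ s) - log λ(γ 0)|` for a
  `C¹` path in the far part (fundamental theorem of calculus);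
* `stub_farCollarIsFar` — the registered stub: an almost-minimising `C¹` path from `Ψ(y,l)` to
  `x₀` must leave the compact core `Ψ(N × [δ, t₂ - δ])` of the open far part before its exit time,
  either downwards (`λ < δ`) or upwards (`λ > t₂ - δ`); both cost length `> R + 1`.
Everything is proved (kind = proof); no definitions.
-/

noncomputable section

-- the prescribed namespace `Summit.<P>.<Sub>.…` duplicates `SmoothPoincare4` (P = Sub)
set_option linter.dupNamespace false

open scoped Manifold ContDiff Topology ENNReal NNReal
open Set Function Bundle

namespace Summit.SmoothPoincare4.SmoothPoincare4.Cruxes.C0AhRecognition.Sketch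

open Literature.Topology.FourManifolds (HomotopySphere)
open Literature.Geometry.Lorentzian (PseudoRiemannianMetric mfderivEquivOfInjective
  mfderiv_mfderivEquivOfInjective_symm)

section Collar

variable {N : Type} [TopologicalSpace N] [ChartedSpace (EuclideanSpace ℝ (Fin 4)) N]
  [IsManifold (𝓡 4) ∞ N] [Nonempty N]
  {W : Type} [TopologicalSpace W] [ChartedSpace (EuclideanSpace ℝ (Fin 5)) W]
  [IsManifold (𝓡 5) ∞ W]
  (Ψ : N × ℝ → W) {t₀ T : ℝ} (hT : T ≤ t₀) (ht₀ : t₀ < 1)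
  (hsm : ContMDiffOn ((𝓡 4).prod 𝓘(ℝ, ℝ)) (𝓡 5) ∞ Ψ (univ ×ˢ Ioo (0 : ℝ) 1))
  (hinj : InjOn Ψ (univ ×ˢ Ioo (0 : ℝ) 1))
  (himm : ∀ (y : N) (l : ℝ), l ∈ Ioo (0 : ℝ) t₀ →
    Injective (mfderiv ((𝓡 4).prod 𝓘(ℝ, ℝ)) (𝓡 5) Ψ (y, l)))

include hT ht₀ hsm hinj himm

/-- **Local inverse of the collar map.** If `Ψ` is smooth and injective on `N × (0,1)` and
immersive on `N × (0,t₀)`, `T ≤ t₀ < 1`, then near the image of a point `p ∈ N × (0,T)` every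
point is in `Ψ(N × (0,T))`, and the global inverse `invFunOn Ψ (N × (0,1))` is smooth at `Ψ p`
(it agrees near `Ψ p` with the local inverse given by the inverse function theorem, `4 + 1 = 5`).
[folklore] -/
theorem collar_localInverse {p : N × ℝ} (hp : p ∈ univ ×ˢ Ioo (0 : ℝ) T) :
    (∀ᶠ x in 𝓝 (Ψ p), x ∈ Ψ '' (univ ×ˢ Ioo (0 : ℝ) T)) ∧
    ContMDiffAt (𝓡 5) ((𝓡 4).prod 𝓘(ℝ, ℝ)) ∞ (invFunOn Ψ (univ ×ˢ Ioo (0 : ℝ) 1)) (Ψ p) := by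
  have hΩo : IsOpen (univ ×ˢ Ioo (0 : ℝ) T : Set (N × ℝ)) := isOpen_univ.prod isOpen_Ioo
  have hsub : (univ ×ˢ Ioo (0 : ℝ) T : Set (N × ℝ)) ⊆ univ ×ˢ Ioo (0 : ℝ) 1 :=
    prod_mono Subset.rfl (Ioo_subset_Ioo_right (hT.trans ht₀.le))
  have hdim : Module.finrank ℝ (EuclideanSpace ℝ (Fin 4) × ℝ) =
      Module.finrank ℝ (EuclideanSpace ℝ (Fin 5)) := by
    rw [Module.finrank_prod, finrank_euclideanSpace_fin, finrank_euclideanSpace_fin,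
      Module.finrank_self]
  set L : (EuclideanSpace ℝ (Fin 4) × ℝ) ≃ₗ[ℝ] EuclideanSpace ℝ (Fin 5) :=
    mfderivEquivOfInjective (I := 𝓡 5) (I' := (𝓡 4).prod 𝓘(ℝ, ℝ)) Ψ p
      (himm p.1 p.2 ⟨hp.2.1, hp.2.2.trans_le hT⟩) hdim
  have hloc : IsLocalDiffeomorphAt ((𝓡 4).prod 𝓘(ℝ, ℝ)) (𝓡 5) ∞ Ψ p :=
    Literature.Geometry.Manifold.isLocalDiffeomorphAt_of_mfderiv (by simp) hΩo hp (hsm.mono hsub)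
      L.toContinuousLinearEquiv (by ext u; rfl)
  have hc : ContinuousAt hloc.localInverse (Ψ p) := hloc.localInverse_contMDiffAt.continuousAt
  have hm : (univ ×ˢ Ioo (0 : ℝ) T : Set (N × ℝ)) ∈ 𝓝 (hloc.localInverse (Ψ p)) := by
    rw [hloc.localInverse_left_inv hloc.localInverse_mem_target]
    exact hΩo.mem_nhds hp
  have h3 : ∀ᶠ x in 𝓝 (Ψ p), Ψ (hloc.localInverse x) = x ∧
      hloc.localInverse x ∈ (univ ×ˢ Ioo (0 : ℝ) T : Set (N × ℝ)) := by
    filter_upwards [hloc.localInverse.open_source.mem_nhds hloc.localInverse_mem_source,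
      hc.preimage_mem_nhds hm] with x hx1 hx2
    exact ⟨hloc.localInverse_right_inv hx1, hx2⟩
  refine ⟨h3.mono fun x hx ↦ ⟨_, hx.2, hx.1⟩,
    hloc.localInverse_contMDiffAt.congr_of_eventuallyEq (h3.mono fun x hx ↦ ?_)⟩
  have h := hinj.leftInvOn_invFunOn (hsub hx.2)
  rwa [hx.1] at h

/-- **The logarithmic depth** `x ↦ log λ(x)`, `λ = pr₂ ∘ Ψ⁻¹`, is smooth at every point of the
far part `Ψ(N × (0,T))`. [folklore] -/
theorem contMDiffAt_logDepth {p : N × ℝ} (hp : p ∈ univ ×ˢ Ioo (0 : ℝ) T) :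
    ContMDiffAt (𝓡 5) 𝓘(ℝ, ℝ) ∞
      (fun x ↦ Real.log (invFunOn Ψ (univ ×ˢ Ioo (0 : ℝ) 1) x).2) (Ψ p) := by
  have hval : (invFunOn Ψ (univ ×ˢ Ioo (0 : ℝ) 1) (Ψ p)).2 ≠ 0 := by
    rw [hinj.leftInvOn_invFunOn ⟨mem_univ _, hp.2.1, hp.2.2.trans_le (hT.trans ht₀.le)⟩]
    exact hp.2.1.ne'
  exact (contMDiffAt_iff_contDiffAt.2 (Real.contDiffAt_log.2 hval)).comp (Ψ p)
    (contMDiffAt_snd.comp (Ψ p) (collar_localInverse Ψ hT ht₀ hsm hinj himm hp).2)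

/-- **Differential of the logarithmic depth along the collar**: for `(y, l) ∈ N × (0,T)` and a
tangent vector `(v, s)` at `(y, l)`, `d(log λ)(dΨ (v, s)) = s / l` (chain rule, `λ ∘ Ψ = pr₂`
near `(y, l)`). [folklore] -/
theorem mfderiv_logDepth_mfderiv {y : N} {l : ℝ} (hl : l ∈ Ioo (0 : ℝ) T)
    (v : TangentSpace (𝓡 4) y) (s : ℝ) :
    mfderiv (𝓡 5) 𝓘(ℝ, ℝ) (fun x ↦ Real.log (invFunOn Ψ (univ ×ˢ Ioo (0 : ℝ) 1) x).2) (Ψ (y, l))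
      (mfderiv ((𝓡 4).prod 𝓘(ℝ, ℝ)) (𝓡 5) Ψ (y, l) (v, s)) = s / l := by
  set F : W → ℝ := fun x ↦ Real.log (invFunOn Ψ (univ ×ˢ Ioo (0 : ℝ) 1) x).2 with hF
  have hsub : (univ ×ˢ Ioo (0 : ℝ) T : Set (N × ℝ)) ⊆ univ ×ˢ Ioo (0 : ℝ) 1 :=
    prod_mono Subset.rfl (Ioo_subset_Ioo_right (hT.trans ht₀.le))
  have hp : ((y, l) : N × ℝ) ∈ (univ ×ˢ Ioo (0 : ℝ) T : Set (N × ℝ)) := ⟨mem_univ _, hl⟩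
  have hΨd : MDifferentiableAt ((𝓡 4).prod 𝓘(ℝ, ℝ)) (𝓡 5) Ψ (y, l) :=
    (hsm.contMDiffAt ((isOpen_univ.prod isOpen_Ioo).mem_nhds (hsub hp))).mdifferentiableAt
      (by simp)
  have hcomp : HasMFDerivAt ((𝓡 4).prod 𝓘(ℝ, ℝ)) 𝓘(ℝ, ℝ) (F ∘ Ψ) (y, l)
      ((mfderiv (𝓡 5) 𝓘(ℝ, ℝ) F (Ψ (y, l))).comp (mfderiv ((𝓡 4).prod 𝓘(ℝ, ℝ)) (𝓡 5) Ψ (y, l))) :=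
    ((contMDiffAt_logDepth Ψ hT ht₀ hsm hinj himm hp).mdifferentiableAt
      (by simp)).hasMFDerivAt.comp (y, l) hΨd.hasMFDerivAt
  -- the model computation: `F ∘ Ψ = log ∘ pr₂` near `(y, l)`
  have hlog : HasMFDerivAt 𝓘(ℝ, ℝ) 𝓘(ℝ, ℝ) Real.log l
      ((1 : ℝ →L[ℝ] ℝ).smulRight (l⁻¹ : ℝ)) :=
    (Real.hasDerivAt_log hl.1.ne').hasFDerivAt.hasMFDerivAt
  have hmodel : HasMFDerivAt ((𝓡 4).prod 𝓘(ℝ, ℝ)) 𝓘(ℝ, ℝ) (Real.log ∘ (Prod.snd : N × ℝ → ℝ)) (y, l)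
      (((1 : ℝ →L[ℝ] ℝ).smulRight (l⁻¹ : ℝ)).comp
        (ContinuousLinearMap.snd ℝ (TangentSpace (𝓡 4) y) (TangentSpace 𝓘(ℝ, ℝ) l))) :=
    hlog.comp (y, l) (hasMFDerivAt_snd (I := 𝓡 4) (I' := 𝓘(ℝ, ℝ)) (y, l))
  have heq : F ∘ Ψ =ᶠ[𝓝 ((y, l) : N × ℝ)] Real.log ∘ (Prod.snd : N × ℝ → ℝ) := by
    filter_upwards [(isOpen_univ.prod isOpen_Ioo).mem_nhds hp] with q hq
    simp only [comp_apply, hF, hinj.leftInvOn_invFunOn (hsub hq)]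
  have h2 := (hmodel.congr_of_eventuallyEq heq).mfderiv
  rw [hcomp.mfderiv] at h2
  have h4 : mfderiv (𝓡 5) 𝓘(ℝ, ℝ) F (Ψ (y, l))
      (mfderiv ((𝓡 4).prod 𝓘(ℝ, ℝ)) (𝓡 5) Ψ (y, l) (v, s)) = s * l⁻¹ :=
    DFunLike.congr_fun h2 (v, s)
  rw [h4, div_eq_mul_inv]

variable
  (G : PseudoRiemannianMetric (𝓡 5) ∞ (EuclideanSpace ℝ (Fin 5)) (TangentSpace (𝓡 5) : W → Type _))
  (hG : G.IsRiemannian)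
  (gN : PseudoRiemannianMetric (𝓡 4) ∞ (EuclideanSpace ℝ (Fin 4)) (TangentSpace (𝓡 4) : N → Type _))
  {c t₁ : ℝ} (hc : 0 < c) (hgN : gN.IsRiemannian) (hT₁ : T ≤ t₁)
  (hasy : ∀ (y : N) (l : ℝ), l ∈ Ioo (0 : ℝ) t₁ → ∀ (v : TangentSpace (𝓡 4) y) (s : ℝ),
    |G.val (Ψ (y, l)) (mfderiv ((𝓡 4).prod 𝓘(ℝ, ℝ)) (𝓡 5) Ψ (y, l) (v, s))
        (mfderiv ((𝓡 4).prod 𝓘(ℝ, ℝ)) (𝓡 5) Ψ (y, l) (v, s)) -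
      c * (s ^ 2 + gN.val y v v) / l ^ 2| ≤ 1 / 2 * (c * (s ^ 2 + gN.val y v v) / l ^ 2))

include hc hgN hT₁ hasy

/-- **The cone asymptotics bound the logarithmic depth differential**: at `x = Ψ(y, l)`, `l < T`,
where `G(dΨ u, dΨ u)` is within a factor `1/2` of `c (s² + gN(v,v))/l²` (`u = (v, s)`), every
tangent vector `w = dΨ u` satisfies `√(c/2) · |d(log λ)(w)| ≤ |w|_G` (`d(log λ)(dΨ u) = s/l` and
`G(w,w) ≥ c s²/(2 l²)` as `gN ≥ 0`). [folklore] -/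
theorem sqrt_mul_abs_le_norm {y : N} {l : ℝ} (hl : l ∈ Ioo (0 : ℝ) T) {x : W} (hx : Ψ (y, l) = x)
    (w : TangentSpace (𝓡 5) x) {a : ℝ}
    (ha : mfderiv (𝓡 5) 𝓘(ℝ, ℝ) (fun z ↦ Real.log (invFunOn Ψ (univ ×ˢ Ioo (0 : ℝ) 1) z).2) x w
      = a) :
    letI := G.riemannianBundle hG
    Real.sqrt (c / 2) * |a| ≤ ‖w‖ := by
  subst hx
  letI := G.riemannianBundle hG
  have hdim : Module.finrank ℝ (EuclideanSpace ℝ (Fin 4) × ℝ) =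
      Module.finrank ℝ (EuclideanSpace ℝ (Fin 5)) := by
    rw [Module.finrank_prod, finrank_euclideanSpace_fin, finrank_euclideanSpace_fin,
      Module.finrank_self]
  have hy : Injective (mfderiv ((𝓡 4).prod 𝓘(ℝ, ℝ)) (𝓡 5) Ψ (y, l)) :=
    himm y l ⟨hl.1, hl.2.trans_le hT⟩
  set u : EuclideanSpace ℝ (Fin 4) × ℝ :=
    (mfderivEquivOfInjective (I := 𝓡 5) (I' := (𝓡 4).prod 𝓘(ℝ, ℝ)) Ψ (y, l) hy hdim).symm w
  have hw : mfderiv ((𝓡 4).prod 𝓘(ℝ, ℝ)) (𝓡 5) Ψ (y, l) (u.1, u.2) = w :=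
    mfderiv_mfderivEquivOfInjective_symm (I := 𝓡 5) (I' := (𝓡 4).prod 𝓘(ℝ, ℝ)) Ψ (y, l) hy hdim w
  have hau : a = u.2 / l := by
    rw [← ha, ← hw]
    exact mfderiv_logDepth_mfderiv Ψ hT ht₀ hsm hinj himm hl u.1 u.2
  have hgN0 : ∀ v : TangentSpace (𝓡 4) y, 0 ≤ gN.val y v v := fun v ↦ by
    by_cases h : v = 0
    · subst h; simp
    · exact (hgN y v h).le
  have hB := (abs_sub_le_iff.1 (hasy y l ⟨hl.1, hl.2.trans_le hT₁⟩ u.1 u.2)).2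
  have hl2 : 0 < l ^ 2 := by have := hl.1; positivity
  have hA : c / 2 * (u.2 / l) ^ 2 ≤ G.val (Ψ (y, l)) w w := by
    rw [← hw, div_pow]
    have h1 : c / 2 * (u.2 ^ 2 / l ^ 2) + c / 2 * (gN.val y u.1 u.1 / l ^ 2) =
        c * (u.2 ^ 2 + gN.val y u.1 u.1) / l ^ 2 -
          1 / 2 * (c * (u.2 ^ 2 + gN.val y u.1 u.1) / l ^ 2) := by
      ring
    have h2 : 0 ≤ c / 2 * (gN.val y u.1 u.1 / l ^ 2) := by have := hgN0 u.1; positivity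
    linarith
  calc Real.sqrt (c / 2) * |a| = Real.sqrt (c / 2 * (u.2 / l) ^ 2) := by
        rw [hau, Real.sqrt_mul (by positivity), Real.sqrt_sq_eq_abs]
    _ ≤ Real.sqrt (G.val (Ψ (y, l)) w w) := Real.sqrt_le_sqrt hA
    _ = ‖w‖ := (PseudoRiemannianMetric.norm_eq_sqrt G hG _ w).symm

/-- **Length of a path in the far part controls its logarithmic depth**: if a `C¹` path `γ` stays
in `Ψ(N × (0,T))` on `[0, s]`, then `L(γ|[0,s]) ≥ √(c/2) · |log λ(γ s) − log λ(γ 0)|` (integrate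
`|γ'|_G ≥ √(c/2) |(log λ ∘ γ)'|`, fundamental theorem of calculus for the `C¹` function
`log λ ∘ γ`). [folklore] -/
theorem ofReal_logDepth_le_pathELength {γ : ℝ → W} (hγ : ContMDiff 𝓘(ℝ, ℝ) (𝓡 5) 1 γ) {s : ℝ}
    (hs : 0 ≤ s) (hγU : ∀ r ∈ Icc 0 s, γ r ∈ Ψ '' (univ ×ˢ Ioo (0 : ℝ) T)) :
    letI := G.riemannianBundle hG
    ENNReal.ofReal (Real.sqrt (c / 2) *
        |Real.log (invFunOn Ψ (univ ×ˢ Ioo (0 : ℝ) 1) (γ s)).2 -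
          Real.log (invFunOn Ψ (univ ×ˢ Ioo (0 : ℝ) 1) (γ 0)).2|) ≤
      Manifold.pathELength (𝓡 5) γ 0 s := by
  letI := G.riemannianBundle hG
  set F : W → ℝ := fun z ↦ Real.log (invFunOn Ψ (univ ×ˢ Ioo (0 : ℝ) 1) z).2
  have hFat : ∀ r ∈ Icc 0 s, ContMDiffAt (𝓡 5) 𝓘(ℝ, ℝ) ∞ F (γ r) := fun r hr ↦ by
    obtain ⟨p, hp, hpr⟩ := hγU r hr
    exact hpr ▸ contMDiffAt_logDepth Ψ hT ht₀ hsm hinj himm hp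
  have hΛ : ContDiffOn ℝ 1 (F ∘ γ) (Icc 0 s) := contMDiffOn_iff_contDiffOn.1 fun r hr ↦
    ((hFat r hr).of_le (by exact_mod_cast le_top)).comp_contMDiffWithinAt r
      (hγ r).contMDiffWithinAt
  have h2 : ∀ r ∈ Icc 0 s, ENNReal.ofReal (Real.sqrt (c / 2)) * ‖deriv (F ∘ γ) r‖ₑ ≤
      ‖mfderiv 𝓘(ℝ, ℝ) (𝓡 5) γ r 1‖ₑ := fun r hr ↦ by
    obtain ⟨⟨y, l⟩, hp, hpr⟩ := hγU r hr
    have hcomp : HasMFDerivAt 𝓘(ℝ, ℝ) 𝓘(ℝ, ℝ) (F ∘ γ) r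
        ((mfderiv (𝓡 5) 𝓘(ℝ, ℝ) F (γ r)).comp (mfderiv 𝓘(ℝ, ℝ) (𝓡 5) γ r)) :=
      ((hFat r hr).mdifferentiableAt (by simp)).hasMFDerivAt.comp r
        ((hγ r).mdifferentiableAt (by simp)).hasMFDerivAt
    have e2 : fderiv ℝ (F ∘ γ) r = mfderiv 𝓘(ℝ, ℝ) 𝓘(ℝ, ℝ) (F ∘ γ) r :=
      (mfderiv_eq_fderiv (f := F ∘ γ) (x := r)).symm
    have hderiv : mfderiv (𝓡 5) 𝓘(ℝ, ℝ) F (γ r) (mfderiv 𝓘(ℝ, ℝ) (𝓡 5) γ r 1) =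
        deriv (F ∘ γ) r := by
      rw [show deriv (F ∘ γ) r = fderiv ℝ (F ∘ γ) r 1 from rfl, e2, hcomp.mfderiv]
      rfl
    have hb := sqrt_mul_abs_le_norm Ψ hT ht₀ hsm hinj himm G hG gN hc hgN hT₁ hasy hp.2 hpr _
      hderiv
    calc ENNReal.ofReal (Real.sqrt (c / 2)) * ‖deriv (F ∘ γ) r‖ₑ
        = ENNReal.ofReal (Real.sqrt (c / 2) * |deriv (F ∘ γ) r|) := by
          rw [Real.enorm_eq_ofReal_abs, ENNReal.ofReal_mul (Real.sqrt_nonneg _)]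
      _ ≤ ‖mfderiv 𝓘(ℝ, ℝ) (𝓡 5) γ r 1‖ₑ := (ENNReal.ofReal_le_ofReal hb).trans_eq (ofReal_norm _)
  calc ENNReal.ofReal (Real.sqrt (c / 2) * |F (γ s) - F (γ 0)|)
      = ENNReal.ofReal (Real.sqrt (c / 2)) * ‖(F ∘ γ) s - (F ∘ γ) 0‖ₑ := by
        rw [ENNReal.ofReal_mul (Real.sqrt_nonneg _), Real.enorm_eq_ofReal_abs]
        rfl
    _ ≤ ENNReal.ofReal (Real.sqrt (c / 2)) * ∫⁻ r in Icc 0 s, ‖deriv (F ∘ γ) r‖ₑ := by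
        gcongr
        exact enorm_sub_le_lintegral_deriv_of_contDiffOn_Icc hΛ hs
    _ = ∫⁻ r in Icc 0 s, ENNReal.ofReal (Real.sqrt (c / 2)) * ‖deriv (F ∘ γ) r‖ₑ :=
        (MeasureTheory.lintegral_const_mul' _ _ ENNReal.ofReal_ne_top).symm
    _ ≤ ∫⁻ r in Icc 0 s, ‖mfderiv 𝓘(ℝ, ℝ) (𝓡 5) γ r 1‖ₑ :=
        MeasureTheory.setLIntegral_mono' measurableSet_Icc h2
    _ = Manifold.pathELength (𝓡 5) γ 0 s := Manifold.pathELength_eq_lintegral_mfderiv_Icc.symm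

end Collar

/-- **Stub C (`farCollarIsFar`).** For a `C⁰`-cone collar `Ψ : N × (0,1) → W` (smooth, injective,
immersive on `N × (0,t₀)`, `G ∘ dΨ = (1 + o(1)) c (dl² + gN)/l²`) over a compact `N`, the depth
coordinate controls the distance from any base point: for every `x₀ ∈ W` and `R ≥ 0` there is
`t ∈ (0,1)` with `d_G(x₀, Ψ(y,l)) > R` for all `y` and all `l < t`. Proof: a `C¹` path from `Ψ(y,l)` to
`x₀` leaves the open far part `Ψ(N × (0,t₂))` (a homeomorphic, locally diffeomorphic image) a first
time; until then it reads `Ψ(σ(s), λ(s))` with `|γ'(s)|_G ≥ √(c/2)·|λ'(s)|/λ(s)`, so its length is at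
least `√(c/2)·log(t₂/l)` (it cannot descend to `λ → 0` at finite length, and cannot stop inside).
[folklore] -/
theorem stub_farCollarIsFar
    (N : Type) [TopologicalSpace N] [T2Space N] [SecondCountableTopology N] [CompactSpace N]
    [ChartedSpace (EuclideanSpace ℝ (Fin 4)) N] [IsManifold (𝓡 4) ∞ N]
    (gN : PseudoRiemannianMetric (𝓡 4) ∞ (EuclideanSpace ℝ (Fin 4)) (TangentSpace (𝓡 4) : N → Type _))
    (hgN : gN.IsRiemannian)
    (W : Type) [TopologicalSpace W] [T2Space W] [SecondCountableTopology W]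
    [ChartedSpace (EuclideanSpace ℝ (Fin 5)) W] [IsManifold (𝓡 5) ∞ W]
    (G : PseudoRiemannianMetric (𝓡 5) ∞ (EuclideanSpace ℝ (Fin 5)) (TangentSpace (𝓡 5) : W → Type _))
    (hG : G.IsRiemannian)
    (c : ℝ) (Ψ : N × ℝ → W) (hc : 0 < c)
    (hsm : ContMDiffOn ((𝓡 4).prod 𝓘(ℝ, ℝ)) (𝓡 5) ∞ Ψ (univ ×ˢ Ioo (0 : ℝ) 1))
    (hinj : InjOn Ψ (univ ×ˢ Ioo (0 : ℝ) 1))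
    (himm : ∃ t₀ ∈ Ioo (0 : ℝ) 1, ∀ (y : N) (l : ℝ), l ∈ Ioo (0 : ℝ) t₀ →
      Injective (mfderiv ((𝓡 4).prod 𝓘(ℝ, ℝ)) (𝓡 5) Ψ (y, l)))
    (hasym : ∀ ε : ℝ, 0 < ε → ∃ t ∈ Ioo (0 : ℝ) 1, ∀ (y : N) (l : ℝ), l ∈ Ioo (0 : ℝ) t →
      ∀ (v : TangentSpace (𝓡 4) y) (s : ℝ),
        |G.val (Ψ (y, l)) (mfderiv ((𝓡 4).prod 𝓘(ℝ, ℝ)) (𝓡 5) Ψ (y, l) (v, s))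
            (mfderiv ((𝓡 4).prod 𝓘(ℝ, ℝ)) (𝓡 5) Ψ (y, l) (v, s)) -
          c * (s ^ 2 + gN.val y v v) / l ^ 2| ≤ ε * (c * (s ^ 2 + gN.val y v v) / l ^ 2)) :
    ∀ (x₀ : W) (R : NNReal), ∃ t ∈ Ioo (0 : ℝ) 1, ∀ (y : N) (l : ℝ), l ∈ Ioo (0 : ℝ) t →
      (R : ℝ≥0∞) < G.edist hG x₀ (Ψ (y, l)) := by
  intro x₀ R
  letI := G.riemannianBundle hG
  obtain ⟨t₀, ht₀, himm⟩ := himm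
  obtain ⟨t₁, ht₁, hasy⟩ := hasym (1 / 2) one_half_pos
  -- below the depth `T` the collar is immersive and `1/2`-conical
  set T : ℝ := min t₀ t₁
  have hT0 : 0 < T := lt_min ht₀.1 ht₁.1
  have hTt₀ : T ≤ t₀ := min_le_left _ _
  have hT1 : T < 1 := hTt₀.trans_lt ht₀.2
  -- the exit level `t₂ ≤ T`, with `x₀ ∉ D = Ψ(N × (0,t₂))`
  obtain ⟨t₂, ht₂0, ht₂T, hx₀D⟩ :
      ∃ t₂ : ℝ, 0 < t₂ ∧ t₂ ≤ T ∧ x₀ ∉ Ψ '' (univ ×ˢ Ioo (0 : ℝ) t₂) := by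
    by_cases h : x₀ ∈ Ψ '' (univ ×ˢ Ioo (0 : ℝ) T)
    · obtain ⟨p, hp, hpx⟩ := h
      refine ⟨p.2, hp.2.1, hp.2.2.le, ?_⟩
      rintro ⟨q, hq, hqx⟩
      have heq : q = p := hinj ⟨mem_univ _, hq.2.1, hq.2.2.trans (hp.2.2.trans hT1)⟩
        ⟨mem_univ _, hp.2.1, hp.2.2.trans hT1⟩ (hqx.trans hpx.symm)
      exact absurd hq.2.2 (by rw [heq]; exact lt_irrefl _)
    · exact ⟨T, hT0, le_rfl, h⟩
  -- constants: `κ = √(c/2)`, `A = (R + 1)/κ`; the answer is the depth `t = t₂ e^{-A} / 2`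
  set κ : ℝ := Real.sqrt (c / 2)
  have hκ0 : 0 < κ := Real.sqrt_pos.2 (by positivity)
  set A : ℝ := ((R : ℝ) + 1) / κ with hA
  have hA0 : 0 ≤ A := by positivity
  have hκA : κ * A = (R : ℝ) + 1 := by rw [hA]; field_simp
  have ht2e : t₂ * Real.exp (-A) ≤ t₂ :=
    (mul_le_mul_of_nonneg_left (Real.exp_le_one_iff.2 (by linarith)) ht₂0.le).trans_eq (mul_one _)
  refine ⟨t₂ * Real.exp (-A) / 2, ⟨by positivity, by linarith⟩, fun y l hl ↦ ?_⟩
  haveI : Nonempty N := ⟨y⟩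
  have hlt₂ : l < t₂ := by linarith [hl.2]
  by_contra hle
  have hlt : Manifold.riemannianEDist (𝓡 5) (Ψ (y, l)) x₀ < (R : ℝ≥0∞) + 1 := by
    have h1 : G.edist hG (Ψ (y, l)) x₀ ≤ R := by
      rw [PseudoRiemannianMetric.edist_comm]
      exact not_lt.1 hle
    exact h1.trans_lt (ENNReal.lt_add_right ENNReal.coe_ne_top one_ne_zero)
  obtain ⟨γ, hγ0, hγ1, hγsm, hγlen, -⟩ :=
    Manifold.exists_lt_locally_constant_of_riemannianEDist_lt hlt zero_lt_one
  -- the far part `D` is open and contains `γ 0 = Ψ (y, l)` but not `γ 1 = x₀`: exit time `τ`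
  set D : Set W := Ψ '' (univ ×ˢ Ioo (0 : ℝ) t₂)
  have hDo : IsOpen D := by
    rw [isOpen_iff_mem_nhds]
    rintro _ ⟨p, hp, rfl⟩
    exact (collar_localInverse Ψ (ht₂T.trans hTt₀) ht₀.2 hsm hinj himm hp).1
  have hDU : D ⊆ Ψ '' (univ ×ˢ Ioo (0 : ℝ) T) :=
    image_mono (prod_mono Subset.rfl (Ioo_subset_Ioo_right ht₂T))
  have hγ0D : γ 0 ∈ D := hγ0 ▸ ⟨(y, l), ⟨mem_univ _, hl.1, hlt₂⟩, rfl⟩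
  set Sx : Set ℝ := Icc (0 : ℝ) 1 ∩ γ ⁻¹' Dᶜ
  have hSbdd : BddBelow Sx := ⟨0, fun r hr ↦ hr.1.1⟩
  set τ : ℝ := sInf Sx
  have hτS : τ ∈ Sx :=
    (isClosed_Icc.inter (hDo.isClosed_compl.preimage hγsm.continuous)).csInf_mem
      ⟨1, ⟨zero_le_one, le_rfl⟩, by rw [mem_preimage, hγ1]; exact hx₀D⟩ hSbdd
  have hτD : γ τ ∉ D := hτS.2
  have hτ0 : 0 < τ := hτS.1.1.lt_of_ne (by rintro h; rw [← h] at hτD; exact hτD hγ0D)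
  have hbefore : ∀ r ∈ Ico (0 : ℝ) τ, γ r ∈ D := fun r hr ↦ by
    by_contra hrD
    exact absurd hr.2 (not_lt.2 (csInf_le hSbdd ⟨⟨hr.1, hr.2.le.trans hτS.1.2⟩, hrD⟩))
  -- the compact core `K = Ψ(N × [δ, t₂ - δ])` of `D` is left before the exit time
  set δ : ℝ := min (t₂ / 2) (l * Real.exp (-A))
  have hδ0 : 0 < δ := lt_min (by positivity) (mul_pos hl.1 (Real.exp_pos _))
  have hδ1 : δ ≤ t₂ / 2 := min_le_left _ _
  have hIsub : (univ ×ˢ Icc δ (t₂ - δ) : Set (N × ℝ)) ⊆ univ ×ˢ Ioo 0 t₂ :=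
    prod_mono Subset.rfl fun m hm ↦ ⟨hδ0.trans_le hm.1, by linarith [hm.2]⟩
  set K : Set W := Ψ '' (univ ×ˢ Icc δ (t₂ - δ))
  have hKc : IsCompact K := (isCompact_univ.prod isCompact_Icc).image_of_continuousOn
    (hsm.continuousOn.mono (hIsub.trans (prod_mono Subset.rfl
      (Ioo_subset_Ioo_right (ht₂T.trans hT1.le)))))
  obtain ⟨s, hs, hsK⟩ : ∃ s ∈ Ico (0 : ℝ) τ, γ s ∉ K := by
    by_contra h
    push Not at h
    have hmem : γ τ ∈ closure (γ '' Ico (0 : ℝ) τ) :=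
      hγsm.continuous.continuousWithinAt.mem_closure_image
        (by rw [closure_Ico hτ0.ne]; exact right_mem_Icc.2 hτ0.le)
    exact hτD (image_mono hIsub (hKc.isClosed.closure_subset_iff.2
      (by rintro _ ⟨r, hr, rfl⟩; exact h r hr) hmem))
  -- `γ s = Ψ q` with `q.2 < δ` or `q.2 > t₂ - δ`, and `L(γ|[0,s]) ≥ κ |log q.2 - log l| > R + 1`
  obtain ⟨q, hq, hqs⟩ := hbefore s hs
  have hqK : q.2 < δ ∨ t₂ - δ < q.2 := by
    by_contra hcon
    push Not at hcon
    exact hsK ⟨q, ⟨mem_univ _, hcon.1, hcon.2⟩, hqs⟩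
  have hlen := ofReal_logDepth_le_pathELength Ψ hTt₀ ht₀.2 hsm hinj himm G hG gN hc hgN
    (min_le_right _ _) hasy hγsm hs.1 fun r hr ↦ hDU (hbefore r ⟨hr.1, hr.2.trans_lt hs.2⟩)
  have hF0 : (invFunOn Ψ (univ ×ˢ Ioo (0 : ℝ) 1) (γ 0)).2 = l := by
    rw [hγ0, hinj.leftInvOn_invFunOn ⟨mem_univ _, hl.1, (hlt₂.trans_le ht₂T).trans hT1⟩]
  have hFs : (invFunOn Ψ (univ ×ˢ Ioo (0 : ℝ) 1) (γ s)).2 = q.2 := by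
    rw [← hqs, hinj.leftInvOn_invFunOn ⟨mem_univ _, hq.2.1, hq.2.2.trans (ht₂T.trans_lt hT1)⟩]
  rw [hF0, hFs] at hlen
  have hlog : A < |Real.log q.2 - Real.log l| := by
    rcases hqK with h | h
    · have h2 := Real.log_lt_log hq.2.1 (h.trans_le (min_le_right _ _))
      rw [Real.log_mul hl.1.ne' (Real.exp_pos _).ne', Real.log_exp] at h2
      rw [abs_sub_comm]
      exact lt_of_lt_of_le (by linarith) (le_abs_self _)
    · have h3 : l * Real.exp A < q.2 := by
        have hE : Real.exp (-A) * Real.exp A = 1 := by rw [← Real.exp_add]; simp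
        nlinarith [Real.exp_pos A, Real.exp_pos (-A), hl.2]
      have h4 := Real.log_lt_log (mul_pos hl.1 (Real.exp_pos _)) h3
      rw [Real.log_mul hl.1.ne' (Real.exp_pos _).ne', Real.log_exp] at h4
      exact lt_of_lt_of_le (by linarith) (le_abs_self _)
  have hR1 : (R : ℝ) + 1 < κ * |Real.log q.2 - Real.log l| :=
    hκA ▸ mul_lt_mul_of_pos_left hlog hκ0
  have hfin : (R : ℝ≥0∞) + 1 < Manifold.pathELength (𝓡 5) γ 0 1 :=
    calc (R : ℝ≥0∞) + 1 = ENNReal.ofReal ((R : ℝ) + 1) := by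
          rw [ENNReal.ofReal_add R.coe_nonneg zero_le_one, ENNReal.ofReal_coe_nnreal,
            ENNReal.ofReal_one]
      _ < ENNReal.ofReal (κ * |Real.log q.2 - Real.log l|) :=
          (ENNReal.ofReal_lt_ofReal_iff_of_nonneg (by positivity)).2 hR1
      _ ≤ Manifold.pathELength (𝓡 5) γ 0 s := hlen
      _ ≤ Manifold.pathELength (𝓡 5) γ 0 1 :=
          Manifold.pathELength_mono le_rfl (hs.2.le.trans hτS.1.2)
  exact lt_irrefl _ (hfin.trans hγlen)

end Summit.SmoothPoincare4.SmoothPoincare4.Cruxes.C0AhRecognition.Sketch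

end
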